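import Literature.AlgebraicGeometry.Resolution.ValueGroupRankData
import Literature.AlgebraicGeometry.Resolution.TranscendenceDefect
import HarnessLib

/-!
# The choice (46) for an arbitrary base ring, the bound `r ≤ tr.deg._k(E)` by Abhyankar's inequality

Topic: `Literature/AlgebraicGeometry/Resolution` (proofs only; no new notions, no new named
facts). `ValueGroupRankData.lean` (`exists_rank_data`) produces Cossart–Piltant's rank data
("`f₁, …, f_r ∈ A` such that `v(f₁), …, v(f_r)` are `ℚ`-linearly independent in `Γ_v`", with
relations among any `> r` values) for a REGULAR excellent local ring of dimension `3`, bounding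
`r ≤ 3` through embedded resolution of surfaces. In Cossart–Piltant 2019's descent (J. Algebra
529 (2019) = arXiv:1412.0868, proof of Prop. 4.8: "Let also `f₁, …, f_r ∈ A` such that
`v(f₁), …, v(f_r)` are `ℚ`-linearly independent in `Γ_v` and set `h := g f₁ ⋯ f_r ∈ A`") the
ring `A` is the SINGULAR local ring to be uniformized, and the bound is Abhyankar's inequality
`rat.rk(v) ≤ tr.deg._k(K)` over the ground field `k` on which `v` is trivial:

* `card_le_of_independent_values` — nonzero elements of `K` with multiplicatively independent
  values number at most `N` whenever `tr.deg._k(K) ≤ N` and `k ⊆ O` (values `ℤ`-independent ⇒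
  monomials with distinct values ⇒ algebraically independent over `k`,
  `algebraicIndependent_sumElim_of_valuation`);
* `exists_rank_data_of_trdeg_le` — the rank data for any `S → E` injective with `E` algebraic
  over `S`, `k ⊆ O_E`, `tr.deg._k(E) ≤ N`, and some element of `S` of value in `(0, 1)`.

## Sources

* V. Cossart, O. Piltant, J. Algebra 529 (2019) 268–535 = arXiv:1412.0868, proof of Prop. 4.8
  (arXiv v1: Prop. 4.6, p. 53). [CossartPiltant2019]
* M. Temkin, *Inseparable local uniformization*, J. Algebra 373 (2013), §2.1 (Abhyankar's
  inequality). [Temkin2013]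
-/

noncomputable section

namespace Literature.AlgebraicGeometry.Resolution

universe u v

open IsLocalRing Cardinal

section Bound

variable {K : Type v} [Field K] (O : ValuationSubring K) (k : Type u) [Field k] [Algebra k K]

/-- **At most `tr.deg._k(K)` multiplicatively independent values.** If `k ⊆ O` (the valuation is
trivial on `k`) and `tr.deg._k(K) ≤ N`, then any family `y₁, …, y_n` of nonzero elements of `K`
whose values are multiplicatively independent (`∏ v(yᵢ)^{pᵢ} = ∏ v(yᵢ)^{mᵢ}` only for `p = m`)
has `n ≤ N`: the values are `ℤ`-independent, so the monomials in the `yᵢ` have distinct values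
and the `yᵢ` are algebraically independent over `k` (Abhyankar's inequality, the case of an empty
residue family). [cite: Temkin2013, Section 2.1 (p. 10)] -/
theorem card_le_of_independent_values (hk : ∀ c : k, algebraMap k K c ∈ O) (N : ℕ)
    (hN : Algebra.trdeg k K ≤ N) {n : ℕ} (y : Fin n → K) (hy0 : ∀ i, y i ≠ 0)
    (hind : ∀ p m : Fin n → ℕ, ∏ i, O.valuation (y i) ^ p i = ∏ i, O.valuation (y i) ^ m i →
      p = m) : n ≤ N := by
  classical
  letI := algebraOfMem k O hk
  haveI := isScalarTower_algebraOfMem (k := k) O hk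
  -- the values are `ℤ`-linearly independent
  set U : Fin n → (ValuationSubring.ValueGroup O)ˣ := fun j =>
    Units.mk0 (O.valuation (y j)) (valuation_ne_zero_of_ne_zero O (hy0 j)) with hU
  have hli : LinearIndependent ℤ fun j => Additive.ofMul (U j) := by
    rw [Fintype.linearIndependent_iff]
    intro g hg
    have hmul : ∏ j, U j ^ g j = 1 := by
      have := congrArg Additive.toMul hg
      simpa only [toMul_sum, toMul_zsmul, toMul_ofMul, toMul_zero] using this
    -- positive and negative parts
    let p : Fin n → ℕ := fun j => (g j).toNat
    let m : Fin n → ℕ := fun j => (-g j).toNat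
    have hpm : ∀ j, g j = (p j : ℤ) - (m j : ℤ) := fun j => (Int.toNat_sub_toNat_neg (g j)).symm
    have hprod : ∏ j, U j ^ (p j : ℤ) = ∏ j, U j ^ (m j : ℤ) := by
      have h1 : ∏ j, U j ^ g j = (∏ j, U j ^ (p j : ℤ)) * (∏ j, U j ^ (m j : ℤ))⁻¹ := by
        rw [← Finset.prod_inv_distrib, ← Finset.prod_mul_distrib]
        refine Finset.prod_congr rfl fun j _ => ?_
        rw [hpm j, zpow_sub]
      rw [h1, mul_inv_eq_one] at hmul
      exact hmul
    have hval : ∏ j, O.valuation (y j) ^ p j = ∏ j, O.valuation (y j) ^ m j := by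
      have := congrArg (fun u : (ValuationSubring.ValueGroup O)ˣ =>
        (u : ValuationSubring.ValueGroup O)) hprod
      simpa only [Units.coe_prod, zpow_natCast, Units.val_pow_eq_pow_val, hU, Units.val_mk0]
        using this
    have hpmeq := hind p m hval
    intro j
    rw [hpm j, show p j = m j from congrFun hpmeq j, sub_self]
  -- hence the `yᵢ` are algebraically independent over `k`
  have hx : AlgebraicIndependent k fun i : Fin 0 => residue O ((Fin.elim0 i : O)) :=
    algebraicIndependent_empty_type_iff.mpr (algebraMap k (ResidueField O)).injective
  have hai := algebraicIndependent_sumElim_of_valuation O (fun i : Fin 0 => (Fin.elim0 i : O)) hx y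
    (injective_valuation_prod_pow O y hy0 hli)
  have h1 := hai.lift_cardinalMk_le_trdeg
  rw [Cardinal.mk_sum, Cardinal.mk_fin, Cardinal.mk_fin] at h1
  have h2 : Cardinal.lift.{0} (Algebra.trdeg k K) ≤ (N : Cardinal) := by
    have := Cardinal.lift_le.{0}.mpr hN
    simpa using this
  have h3 : ((n : Cardinal.{v})) ≤ (N : Cardinal.{v}) := by
    have h1' : (n : Cardinal.{v}) ≤ Cardinal.lift.{0} (Algebra.trdeg k K) := by
      simpa using h1
    exact h1'.trans h2
  exact_mod_cast h3

end Bound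

section RankData

variable {S : Type u} [CommRing S] {E : Type u} [Field E] [Algebra S E] [Algebra.IsAlgebraic S E]

set_option maxHeartbeats 800000 in
/-- **The choice (46) for an arbitrary base** (Cossart–Piltant 2019, proof of Prop. 4.8: "Let
also `f₁, …, f_r ∈ A` such that `v(f₁), …, v(f_r)` are `ℚ`-linearly independent in `Γ_v`"):
for `S → E` injective with `E` algebraic over `S`, a valuation ring `O_E ⊇ k` of `E` with
`tr.deg._k(E) ≤ N`, and some element of `S` of value in `(0, 1)`, there are `0 < r ≤ N` nonzero
`s₁, …, s_r ∈ S` with multiplicatively independent values on which the value of every nonzero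
element of `E` depends rationally; in particular any family of more than `r` nonzero elements of
`E` satisfies a non-trivial multiplicative relation of values. Proof: that of `exists_rank_data`,
the bound `r ≤ N` being `card_le_of_independent_values` (Abhyankar) instead of embedded
resolution. [cite: CossartPiltant2019, proof of Prop. 4.8 (arXiv v1: Prop. 4.6, p. 53)]
[cite: Temkin2013, Section 2.1 (p. 10)] -/
theorem exists_rank_data_of_trdeg_le (k : Type u) [Field k] [Algebra k E]
    (OE : ValuationSubring E) (hk : ∀ c : k, algebraMap k E c ∈ OE) (N : ℕ)
    (hN : Algebra.trdeg k E ≤ N) (hinj : Function.Injective (algebraMap S E))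
    (hne : ∃ s : S, algebraMap S E s ≠ 0 ∧ OE.valuation (algebraMap S E s) < 1) :
    ∃ (r : ℕ) (s : Fin r → S), 0 < r ∧ r ≤ N ∧ (∀ i, s i ≠ 0) ∧
      (∀ p m : Fin r → ℕ, ∏ i, OE.valuation (algebraMap S E (s i)) ^ p i =
        ∏ i, OE.valuation (algebraMap S E (s i)) ^ m i → p = m) ∧
      (∀ y : E, y ≠ 0 → ∃ (n : ℕ) (a b : Fin r → ℕ), 0 < n ∧
        OE.valuation y ^ n * ∏ i, OE.valuation (algebraMap S E (s i)) ^ b i =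
          ∏ i, OE.valuation (algebraMap S E (s i)) ^ a i) ∧
      (∀ (d : ℕ) (I : Finset (Fin d)) (y : Fin d → E), r < I.card → (∀ k, y k ≠ 0) →
        ∃ c : Fin d → ℤ, (∀ k, k ∉ I → c k = 0) ∧ c ≠ 0 ∧
          ∏ k, OE.valuation (y k) ^ (c k).toNat = ∏ k, OE.valuation (y k) ^ (-c k).toNat) := by
  classical
  obtain ⟨s₀, hs₀0, hs₀1⟩ := hne
  -- the maximal independent family inside the image of `S`
  obtain ⟨r, g, hr0, hrN, hgB, hg0, hgind, hgmax⟩ :=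
    exists_maximal_independent_family OE (Set.range (algebraMap S E)) N
      (fun n y _ hy0 hyind => card_le_of_independent_values OE k hk N hN y hy0 hyind)
      ⟨algebraMap S E s₀, ⟨s₀, rfl⟩, hs₀0, hs₀1⟩
  choose s hs using fun i => hgB i
  have hs0 : ∀ i, s i ≠ 0 := fun i h0 => hg0 i (by rw [← hs i, h0, map_zero])
  have hgs : ∀ i, OE.valuation (algebraMap S E (s i)) = OE.valuation (g i) := fun i => by
    rw [hs i]
  -- every nonzero element of `E` depends on them (`E` algebraic over `S`)
  have hspan : ∀ y : E, y ≠ 0 → ∃ (n : ℕ) (a b : Fin r → ℕ), 0 < n ∧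
      OE.valuation y ^ n * ∏ i, OE.valuation (g i) ^ b i = ∏ i, OE.valuation (g i) ^ a i :=
    fun y hy0 => exists_dependence_of_isAlgebraic OE hinj g
      (fun s' hs' => hgmax _ ⟨s', rfl⟩ hs') y hy0 (Algebra.IsAlgebraic.isAlgebraic y)
  refine ⟨r, s, hr0, hrN, hs0, fun p m hpm => hgind p m (by simpa only [hgs] using hpm),
    fun y hy0 => by simpa only [hgs] using hspan y hy0, fun d I y hI hy => ?_⟩
  exact exists_relation_of_spanning OE g hg0 hspan I y hI hy

end RankData

end Literature.AlgebraicGeometry.Resolution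

end
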